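import Literature.NumberTheory.DiophantineGeometry.GenEllThm21
import Literature.IUT.LogVolume.Corollary22Statement
import Summits.ABC.ABC.Statement
import HarnessLib

/-!
# Campaign-S endpoint: [IUTchIV] Cor 2.2 ⟹ [GenEll] Thm 2.1 (ii) ⟹ (i)|_{ℙ¹} ⟹ the summit statement `ABC`

Record-and-bridge file of the abc-iut cell (campaign S, TRANCHE-T1 P06); TAKES NO SIDE in the IUT
dispute and asserts nothing disputed (every disputed or unproved input is an explicit hypothesis).
It composes, BY NAME against the summit declaration `ABC` (`Summits/ABC/ABC/Statement.lean`):

* the PROVED Literature bridge `GenEll.abc_of_vojtaIneq_one` — statement (i) of [GenEll] Thm. 2.1 for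
  `ℙ¹ ∖ {0,1,∞}` at `d = 1` gives the displayed abc sentence through the proved `ℚ`-point dictionary
  `ht(a/c) = log c`, `log-diff = 0`, `log-cond = log rad(abc)` (`GenEllThm21.lean`);
* the NAMED FACT `GenEll.GenEll_thm21` — [GenEll] Thm. 2.1, (ii) ⟹ (i)|_{ℙ¹} (classical, refereed,
  granted by Scholze–Stix 2018 §1.2; taken as a hypothesis);
* the typed [IUTchIV] Cor. 2.2 of `Literature.IUT.LogVolume.Cor22` (abc-iut-S3; a predicate
  `Cor22.Corollary22 H_unif`, part of the disputed chain, taken as a hypothesis) with its PROVED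
  bookkeeping `Cor22.bdLe_of_corollary22` (the Cor. 2.2 step of the proof of Cor. 2.3, p. 55);
* the one remaining sentence of the proof of Cor. 2.3 (p. 55), "we may assume without loss of
  generality that … `K_V` satisfies the condition (∗^{j-inv})", as an explicit hypothesis `hwlog`
  (for fixed `d` it follows by shrinking `K_2` to a clopen sublevel set of `|j|`; to be discharged
  separately — it needs the finiteness of the set of extensions of `ℚ_2` of bounded degree).

So, in the kernel: `Cor22.Corollary22 H_unif → ABC` modulo `GenEll_thm21` and `hwlog`
(`abc_of_corollary22`); upstream, `[IUTchIII] Cor 3.12 ⟹ Thm 1.10 ⟹ Cor 2.2` is the Cor-3.12 crew's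
and abc-iut-S3's chain. Sources: [cite: MochizukiGenEll2010, Thm 2.1 p.11]; [IUTchIV] Cor. 2.2 p. 41,
Cor. 2.3 pp. 54–55 [claim: Mochizuki2012, status: disputed] (only the SHAPE of the reduction is used);
Scholze–Stix 2018 §1.1 p. 1 [cite: ScholzeStix2018, §1.1 p. 1]. The real-number shadow of this file is
`Summit.ABC.IUTFork.abc_of_vojtaShape` (skel `ForkAbc.lean`); here the abc dictionary is a theorem.
-/

namespace Summit.ABC.IUTFork

open Literature.NumberTheory.DiophantineGeometry.GenEll Literature.IUT.LogVolume

/-- **[GenEll] Thm 2.1 (i) for `ℙ¹ ∖ {0,1,∞}` at `d = 1` ⟹ `ABC`** (the summit statement, by name):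
if for every `ε > 0` the inequality of BD-classes `ht_{ω_P(C)} ≲ (1+ε)(log-diff_P + log-cond_C)`
holds on `U_P(Q̄)^{≤1}`, then the summit statement `ABC` (Masser–Oesterlé, strong form) holds.
PROVED (dictionary + exponentiation, `GenEllThm21.lean`). [cite: MochizukiGenEll2010, Thm 2.1 p.11] -/
theorem abc_of_vojtaIneq_one (h : ∀ ε : ℝ, 0 < ε → VojtaIneq Set.univ 1 ε) : _root_.ABC := by
  rw [ABC_iff]
  exact Literature.NumberTheory.DiophantineGeometry.GenEll.abc_of_vojtaIneq_one h

/-- **[GenEll] Thm 2.1 (i)|_{ℙ¹} ⟹ `ABC`**: the `ℙ¹ ∖ {0,1,∞}` case of statement (i) of [GenEll]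
Thm. 2.1 for all positive integers `d` — equivalently of the statement of [IUTchIV] Cor. 2.3 —
implies the summit statement. PROVED. [cite: MochizukiGenEll2010, Thm 2.1 p.11] -/
theorem abc_of_vojtaP1Deg (h : ∀ d : ℕ, 0 < d → VojtaP1Deg d) : _root_.ABC :=
  abc_of_vojtaIneq_one (h 1 one_pos)

/-- **Statement (ii) of [GenEll] Thm 2.1 ⟹ `ABC`, modulo the named fact [GenEll] Thm. 2.1**
((ii) ⟹ (i), `GenEll_thm21`, an explicit hypothesis): statement (ii) for `Σ`-supported compactly bounded
subsets of `ℙ¹ ∖ {0,1,∞}` (what [IUTchIV] Cor. 2.2 is used to deliver for `Σ = {2}`, proof of Cor. 2.3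
p. 55) implies the summit statement `ABC`. PROVED modulo the one named fact. **RETIRED (audit
A-Sd2-F1, 2026-08-25): `GenEll_thm21` without the prime binder is abc-strength as typed, so this theorem
(kept because Summits theorem files are append-only) is superseded by `ABC_of_abcCompactlyBounded_primes` /
`ABC_of_abcCompactlyBounded_two_primes` below, which take the FAITHFUL fact `GenEll_thm21_primes`.**
[cite: MochizukiGenEll2010, Thm 2.1 p.11] -/
theorem abc_of_abcCompactlyBounded (hfact : GenEll_thm21) {S : Finset ℕ}
    (h : ABCCompactlyBounded S) : _root_.ABC :=
  abc_of_vojtaP1Deg (hfact S h)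

/-- **[IUTchIV] Cor 2.2 (typed, hypothesis) ⟹ statement (ii) of [GenEll] Thm 2.1 for `Σ = {2}`**, modulo
the "WLOG (∗^{j-inv})" sentence of the proof of Cor. 2.3 (p. 55), taken as the explicit hypothesis `hwlog`:
for each `d, ε`, the inequality for all compactly bounded `K_V` with `2` in the support and (∗^{j-inv})
implies it for all `K_V` with `2` in the support. The Cor. 2.2 ⟹ "inequality on `K_V ∩ U_X(Q̄)^{≤d}`"
step is abc-iut-S3's PROVED `Cor22.bdLe_of_corollary22`. Nothing disputed is asserted.
[claim: Mochizuki2012, status: disputed] -/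
theorem abcCompactlyBounded_two_of_corollary22 {Hunif : ℝ} (h22 : Cor22.Corollary22 Hunif)
    (hwlog : ∀ (d : ℕ) (ε : ℝ),
      (∀ D : CBData, D.SupportContains {2} → Cor22.JInvBounded D → VojtaIneq D.toSet d ε) →
        ∀ D : CBData, D.SupportContains {2} → VojtaIneq D.toSet d ε) :
    ABCCompactlyBounded {2} := by
  intro d hd ε hε D hD
  refine hwlog d ε (fun D' hD' hJ => ?_) D hD
  obtain ⟨hI, hII, hIII⟩ := h22.2 D' ⟨hD', hJ⟩
  exact Cor22.bdLe_of_corollary22 hI hII hIII hd hε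

/-- **Campaign-S endpoint from the typed Cor. 2.2**: `[IUTchIV] Cor 2.2 ⟹ ABC` in the kernel, modulo
(1) the classical named fact [GenEll] Thm. 2.1 ((ii) ⟹ (i), `hfact`) and (2) the "WLOG (∗^{j-inv})"
sentence of the proof of Cor. 2.3 p. 55 (`hwlog`) — both explicit hypotheses; Cor. 2.2 itself (`h22`,
abc-iut-S3's predicate `Cor22.Corollary22`, disputed chain) is the third hypothesis. TAKES NO SIDE.
**RETIRED (audit A-Sd2-F1): takes the abc-strength `GenEll_thm21`; the apex of record is
`abc_of_corollary22_primes` below (faithful fact `GenEll_thm21_primes`).**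
[claim: Mochizuki2012, status: disputed] -/
theorem abc_of_corollary22 (hfact : GenEll_thm21) {Hunif : ℝ} (h22 : Cor22.Corollary22 Hunif)
    (hwlog : ∀ (d : ℕ) (ε : ℝ),
      (∀ D : CBData, D.SupportContains {2} → Cor22.JInvBounded D → VojtaIneq D.toSet d ε) →
        ∀ D : CBData, D.SupportContains {2} → VojtaIneq D.toSet d ε) :
    _root_.ABC :=
  abc_of_abcCompactlyBounded hfact (abcCompactlyBounded_two_of_corollary22 h22 hwlog)


/-! ## The apex over the FAITHFUL named fact `GenEll_thm21_primes` (audit A-Sd2-F1 repair, append-only form)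

[GenEll] Thm. 2.1 reads "Let `Σ` be a finite set of prime numbers" (p. 11). The transcription
`GenEll_thm21` dropped that binder and is abc-strength by vacuity (`CBData.primes_prime`; audit A-Sd2-F1,
kernel witness by abc-iut-S-d2, ref-a correction of p404269). The theorems below re-run the campaign-S
endpoint over the faithful fact `GenEll_thm21_primes` (`GenEllThm21.lean`), applied only at the set of
PRIME numbers `{2}`; they are the declarations of record. The retired theorems above stay (Summits
theorem files are append-only) and are implied by these via `GenEll_thm21_primes_of`. -/

/-- **Statement (ii) of [GenEll] Thm 2.1 for a finite set `Σ` of PRIME numbers ⟹ `ABC`, modulo the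
faithful named fact `GenEll_thm21_primes`** ((ii) ⟹ (i)|_{ℙ¹}). PROVED modulo the one named fact.
[cite: MochizukiGenEll2010, Thm 2.1 p.11] -/
theorem ABC_of_abcCompactlyBounded_primes (hfact : GenEll_thm21_primes) {S : Finset ℕ}
    (hS : ∀ p ∈ S, p.Prime) (h : ABCCompactlyBounded S) : _root_.ABC :=
  abc_of_vojtaP1Deg (hfact S hS h)

/-- **Statement (ii) of [GenEll] Thm 2.1 for `Σ = {2}` ⟹ `ABC`, modulo the faithful named fact
`GenEll_thm21_primes`** (what [IUTchIV] Cor. 2.2 is used to deliver, proof of Cor. 2.3 p. 55), via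
`GenEll.vojtaP1Deg_of_abcCompactlyBounded_two_primes` (`Nat.prime_two`). PROVED modulo the one named fact.
[cite: MochizukiGenEll2010, Thm 2.1 p.11] -/
theorem ABC_of_abcCompactlyBounded_two_primes (hfact : GenEll_thm21_primes)
    (h : ABCCompactlyBounded ({2} : Finset ℕ)) : _root_.ABC :=
  abc_of_vojtaP1Deg fun _ hd => vojtaP1Deg_of_abcCompactlyBounded_two_primes hfact h hd

/-- **Campaign-S endpoint from the typed Cor. 2.2 — DECLARATION OF RECORD (audit A-Sd2-F1 repaired)**:
`[IUTchIV] Cor 2.2 ⟹ ABC` in the kernel, modulo (1) the FAITHFUL classical named fact [GenEll] Thm. 2.1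
((ii) ⟹ (i) for finite sets of PRIME numbers, `hfact : GenEll_thm21_primes`) and (2) the "WLOG (∗^{j-inv})"
sentence of the proof of Cor. 2.3 p. 55 (`hwlog`; discharged from Krasner by abc-iut-S4's
`GenEllJInvReduction.wlog_jInv_of_krasner`) — both explicit hypotheses; Cor. 2.2 itself (`h22`, abc-iut-S3's
predicate `Cor22.Corollary22`, disputed chain) is the third hypothesis. TAKES NO SIDE.
[claim: Mochizuki2012, status: disputed] -/
theorem abc_of_corollary22_primes (hfact : GenEll_thm21_primes) {Hunif : ℝ}
    (h22 : Cor22.Corollary22 Hunif)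
    (hwlog : ∀ (d : ℕ) (ε : ℝ),
      (∀ D : CBData, D.SupportContains {2} → Cor22.JInvBounded D → VojtaIneq D.toSet d ε) →
        ∀ D : CBData, D.SupportContains {2} → VojtaIneq D.toSet d ε) :
    _root_.ABC :=
  ABC_of_abcCompactlyBounded_two_primes hfact (abcCompactlyBounded_two_of_corollary22 h22 hwlog)

end Summit.ABC.IUTFork
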